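import Summits.RiemannHypothesis.RiemannHypothesis.Theses.ShiftedResolvent
import Literature.NumberTheory.LFunctions.WeilResolventVector
import Literature.NumberTheory.LFunctions.WeilWindowSuzukiProofs
import Literature.NumberTheory.LFunctions.WeilGroundStateRealZerosProofs
import Literature.NumberTheory.LFunctions.WeilGroundEnergyProofs
import Literature.NumberTheory.LFunctions.AdversarialWeilPositivity

/-!
# RiemannHypothesis / ShiftedResolvent — REFUTATION of the crux `ResolventRealZeros` AS TYPED
(stmt-RiemannHypothesis-15969) [refuted-misstated: notation-precedence slip]

The route decl inlines the Dirichlet functional of the shifted form as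
`(weilQuadratic h).re - lam * ∫ t, ‖h t‖ ^ 2 - 2 * (weilMellin h (1 / 2)).re` WITHOUT parentheses.
Mathlib's `∫ x, r` parses its body `r` at precedence 60, below `-` (65), so the typed functional is
`Re Q(h) − lam · ∫ (‖h t‖² − 2 Re ĥ(1/2)) dt` — the linear term sits INSIDE the integral (for
`Re ĥ(1/2) ≠ 0` the integrand is not integrable and the Bochner integral is the junk value `0`); the
tree records exactly this trap next to the correctly parenthesised Literature predicate
(`Literature.NumberTheory.LFunctions.weilResolventFunctional_ne_parse`, `IsWeilResolventVector`).

**Witness.** Take `0 < a ≤ a₁` with `0 < ε(a) = weilGroundEnergy a` (unconditional: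
`exists_weilGroundEnergy_pos`, Suzuki 2026 Thm 1.4 positivity, PROVED in tree) and the admissible shift
`lam = 0 < ε(a)`.  At `lam = 0` the typed functional is `J(h) = Re Q(h) ≥ ε(a)·∫‖h‖² ≥ 0`
(`ConnesVanSuijlekom.weilGroundEnergy_mul_le_re`), so `m = 0`, `g_n = 0`, `v = 0` satisfy the typed
inline resolvent-vector predicate; but `weilMellin 0 ≡ 0` vanishes at `s = 0`, `Re 0 ≠ 1/2`.  Hence the
decl is FALSE as typed.  (With the intended parenthesisation the linear term `−2 Re ĥ(1/2)` forbids the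
zero vector — `J` is then minimised at the genuine resolvent vector `(A_a − lam)⁻¹ 1 ≠ 0` — and nothing here
speaks to that statement, to 2001 swrh Thm 1, or to Suzuki 2026 Thm 1.5.)

**Class / repair.** misstated (parse slip, not mathematics).  `C′` = the same decl with
`lam * (∫ t, ‖h t‖ ^ 2)` parenthesised in BOTH occurrences (lower-bound clause and `Tendsto` clause),
equivalently the predicate replaced by `Literature.NumberTheory.LFunctions.IsWeilResolventVector a lam v`;
the witness `v = 0` misses `C′` (for `C′`, `J(c·1_window-test) = c² Re Q − 2c Re ĝ(1/2) < 0` for small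
`c > 0`, so `m < 0 = J(0)` and `0` is not a minimiser).  The sibling decls `ResolventConvergence`
(stmt-15968) and `ResolventVectorExists` (stmt-15970) carry the identical unparenthesised predicate.
RH is untouched: nothing here bears on the truth of RH.
-/

set_option linter.dupNamespace false

namespace Summit.RiemannHypothesis.RiemannHypothesis.Theorems

open MeasureTheory Filter Topology Set
open Literature.NumberTheory.LFunctions

/-- refuted-misstated: `ShiftedResolvent.ResolventRealZeros` is FALSE AS TYPED — its inline
resolvent-vector predicate reads `Re Q(h) − lam·∫(‖h t‖² − 2 Re ĥ(1/2))dt` (unparenthesised `∫`, body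
precedence 60), and at the admissible shift `lam = 0 < ε(a)` (`0 < a ≤ a₁`, `exists_weilGroundEnergy_pos`)
the zero function is a typed "resolvent vector" (`m = 0`, `g_n = 0`; lower bound
`0 ≤ Re Q(h)` from `weilGroundEnergy_mul_le_re`), while `weilMellin 0 ≡ 0` has the zero `s = 0` off
`Re s = 1/2`.  Witness `(a, lam, v) = (a₁, 0, 0)`.  Repaired `C′`: parenthesise `lam * (∫ t, ‖h t‖ ^ 2)`
(both occurrences) / use `IsWeilResolventVector a lam v`; the witness misses `C′`. [folklore] -/
theorem not_ResolventRealZeros :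
    ¬ _root_.Summit.RiemannHypothesis.RiemannHypothesis.Theses.ShiftedResolvent.ResolventRealZeros := by
  intro H
  obtain ⟨a₁, ha₁, hpos⟩ := exists_weilGroundEnergy_pos
  have hε : 0 < weilGroundEnergy a₁ := hpos a₁ ha₁ le_rfl
  have hres := H a₁ ha₁ 0 hε 0 ?_
  · obtain ⟨-, hzeros⟩ := hres
    have h0 := hzeros 0 (by simp)
    norm_num at h0
  · refine ⟨MemLp.zero, fun _ ↦ 0, fun _ ↦ ⟨isWeilTest_zero, ?_⟩, ⟨0, ?_, ?_⟩, ?_⟩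
    · simp
    · intro h hh hsupp
      have hq := ConnesVanSuijlekom.weilGroundEnergy_mul_le_re hh hsupp
      have hn : 0 ≤ ∫ t, ‖h t‖ ^ 2 := integral_nonneg fun _ ↦ by positivity
      have hεn : 0 ≤ weilGroundEnergy a₁ * ∫ t, ‖h t‖ ^ 2 := mul_nonneg hε.le hn
      simp only [zero_mul, sub_zero]
      linarith
    · simp [weilQuadratic_zero]
    · simp
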